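import Mathlib
import Summits.NavierStokesRegularity.NavierStokesRegularity.Theorems.EulerZoomLiouvillePowerGaugeEulerLiouvilleEnergySaturationNegRateTools
import HarnessLib

/-!
# Energy saturation on the crux `EulerZoomLiouville.PowerGaugeEulerLiouville` — NEGATIVE RATES: a profile with class-`ρ` large-scale data
# obeying the self-similar local energy equality with a NEGATIVE drift rate `g < 0` VANISHES
# (crux = stmt-NavierStokesRegularity-19832, route №10 `EulerZoomLiouville`; line `logtime-breathers`, residue T4 `stub_powerClockRest`)

Extra-width seat `ns-ezl-w7` (cell ns-regularity-ideate, LEAD ns-typeII-p2 g11).  PROFILE-LEVEL lever behind «WEAK NEGATIVE-RATE power clocks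
`g < 0` about any `(T, x₀)` on a past sub-slab are trivial» (sequel `…SelfSimilarNegClockPast`): the `g < 0` complement of width seat ns-ezl-w6's
slow-rate theorem `EnergySaturation.ae_eq_zero_of_slowRate_loc` (`0 < g < 2/5`, file `…EnergySaturationSlowRate`, whose proof this file follows
verbatim around the negative-rate tools of `…EnergySaturationNegRateTools`).  Data: `V` with whole-space weak gradient `G`, pressure profile `P`, the
thresholded LARGE-SCALE class data (A₁) `∫_{B_L}|V|² ≤ c L^{1−2ρ}`, (E₁) `∫_{B_L}|G|²_F ≤ ((1−ρ)/(2+ρ))c·L^{1−ρ}`, (D₁)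
`∫_{B_L}|P|^{3/2} ≤ ((2−2ρ)/(2+ρ))c·L^{2−2ρ}` (`L ≥ 1`), the weak Poisson equation, and the profile LOCAL ENERGY EQUALITY of a rate-`g` collapse
`(2 − 5g)∫θ|V|² = ∫(|V|²+2P)⟪V,∇θ⟫ + g∫|V|²⟪x,∇θ⟫` with the rate `g < 0` LITERAL (no `1/(2+ρ')` parametrisation exists for non-positive rates).

* `ae_eq_zero_of_negRate_loc` — MAIN: (A₁), (E₁), (D₁) (`0 < ρ < 1`) + Poisson + the rate-`g` equality with `g < 0` ⇒ `V = 0` a.e.: the scale ODE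
  `(R^κ J)' = g⁻¹R^{κ−1}F`, `κ = (2−5g)/g < −5`, has its boundary term killed AT INFINITY by the class bound, so the floor-free bootstrap
  `negRate_iterate` empties every ball.

(`0 < g < 2/5`: ns-ezl-w6's file, floor `−κ/2 < 0`; `g = 0`: ns-ezl-w6's `…EnergySaturationZeroRate`, `2J = F` directly; `g ∈ [2/5, 1/(2+ρ)]`:
untouched — own-rate extremal growth survives.)  WHAT THIS IS NOT: not NS regularity, not the crux — a lemma for one stratum of the crux CLASS
19832 on the MODEL lattice (`--supports` stmt-19832). [folklore; cf. BronziShvydkoy2015 Thm 1.1, ChaeShvydkoy2013 §2.2 (2.12)]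
-/

noncomputable section

-- flat `Theorems/<Route><Decl>…` files of one crux share the namespace of the crux (tree convention: `Summit.<S>.<S>.…`)
set_option linter.dupNamespace false

open MeasureTheory Set Filter Topology Metric Function TopologicalSpace
open scoped ENNReal NNReal RealInnerProductSpace ContDiff Laplacian

namespace Summit.NavierStokesRegularity.NavierStokesRegularity.Theorems.PowerGaugeEulerLiouville

open Literature.Analysis Literature.Analysis.FunctionSpaces Literature.Analysis.FluidPDE

namespace EnergySaturation

/-! ## Negative-rate profiles with class data are trivial -/

variable {ρ g : ℝ}
  {V : EuclideanSpace ℝ (Fin 3) → EuclideanSpace ℝ (Fin 3)} {P : EuclideanSpace ℝ (Fin 3) → ℝ}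
  {G : EuclideanSpace ℝ (Fin 3) → EuclideanSpace ℝ (Fin 3) →L[ℝ] EuclideanSpace ℝ (Fin 3)}

/-- **NEGATIVE-RATE PROFILES WITH CLASS DATA ARE TRIVIAL.**  `(V, P, G)` with the thresholded class data (A₁), (E₁), (D₁) of DATA exponent
`0 < ρ < 1`, the weak Poisson equation, and the profile local energy EQUALITY of a self-similar collapse with a NEGATIVE drift rate `g < 0`,
`(2 − 5g)∫θ|V|² = ∫(|V|²+2P)⟪V,∇θ⟫ + g∫|V|²⟪x,∇θ⟫` for every test function: `V = 0` a.e. — no sub-extremality, no finite energy, no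
regularity.  (`0 < g < 2/5`: `ae_eq_zero_of_slowRate_loc`, ns-ezl-w6.) [folklore; cf. BronziShvydkoy2015 Thm 1.1] -/
theorem ae_eq_zero_of_negRate_loc (hρ : 0 < ρ) (hρ1 : ρ < 1) (hg : g < 0)
    (hVm : AEStronglyMeasurable V volume) (hPm : AEStronglyMeasurable P volume)
    (hGm : AEStronglyMeasurable G volume)
    (hVG : HasWeakFDerivOn (⊤ : Opens (EuclideanSpace ℝ (Fin 3))) volume V G) {c : ℝ≥0}
    (hA : ∀ L : ℝ, 1 ≤ L → ∫⁻ y in ball (0 : EuclideanSpace ℝ (Fin 3)) L, ‖V y‖ₑ ^ 2 ≤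
      (c : ℝ≥0∞) * ENNReal.ofReal (L ^ (1 - 2 * ρ)))
    (hE : ∀ L : ℝ, 1 ≤ L →
      ∫⁻ y in ball (0 : EuclideanSpace ℝ (Fin 3)) L, ENNReal.ofReal (frobeniusNormSq (G y)) ≤
        ENNReal.ofReal (L ^ (1 - ρ)) * (ENNReal.ofReal ((1 - ρ) / (2 + ρ)) * (c : ℝ≥0∞)))
    (hD : ∀ L : ℝ, 1 ≤ L →
      ∫⁻ y in ball (0 : EuclideanSpace ℝ (Fin 3)) L, ‖P y‖ₑ ^ (3 / 2 : ℝ) ≤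
        ENNReal.ofReal (L ^ (2 - 2 * ρ)) * (ENNReal.ofReal ((2 - 2 * ρ) / (2 + ρ)) * (c : ℝ≥0∞)))
    (hPoisson : ∀ θ : EuclideanSpace ℝ (Fin 3) → ℝ, ContDiff ℝ (⊤ : ℕ∞) θ → HasCompactSupport θ →
      ∫ y, P y * (Δ θ) y = -∫ y, fderiv ℝ (fderiv ℝ θ) y (V y) (V y))
    (hEE : ∀ θ : EuclideanSpace ℝ (Fin 3) → ℝ, IsTestFunctionOn (⊤ : Opens (EuclideanSpace ℝ (Fin 3))) θ →
      (2 - 5 * g) * ∫ x, θ x * ‖V x‖ ^ 2 =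
        (∫ x, (‖V x‖ ^ 2 + 2 * P x) * ⟪V x, gradient θ x⟫) +
          g * ∫ x, ‖V x‖ ^ 2 * ⟪x, gradient θ x⟫) :
    V =ᵐ[volume] 0 := by
  -- adapted from `ae_eq_zero_of_slowRate_loc` (…EnergySaturationSlowRate, ns-ezl-w6): the scale ODE and the bootstrap are the negative-rate ones
  have hc0 : (0 : ℝ) ≤ c := c.2
  have hg0 : g ≠ 0 := hg.ne
  have hV2 : LocallyIntegrable (fun y => ‖V y‖ ^ 2) volume := locallyIntegrable_norm_sq_of_growth_loc hVm hA
  obtain ⟨σ, hσs, hσc, h0, h1, hone, hzero, -⟩ := exists_radialCutoff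
  have hσ : IsTestFunctionOn (⊤ : Opens (EuclideanSpace ℝ (Fin 3))) σ := ⟨hσs, hσc, fun _ _ => trivial⟩
  set J : ℝ → ℝ := fun R => ∫ y, σ (R⁻¹ • y) * ‖V y‖ ^ 2 with hJ
  set F : ℝ → ℝ := fun r => ∫ x, (‖V x‖ ^ 2 + 2 * P x) * ⟪V x, gradient (fun z => σ (r⁻¹ • z)) x⟫ with hF
  have hJ0 : ∀ R : ℝ, 0 < R → 0 ≤ J R := fun R _ =>
    integral_nonneg fun y => mul_nonneg (h0 _) (sq_nonneg _)
  -- ### a NEGATIVE power bound on `J` at large scales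
  have hpow : ∃ m C L₁ : ℝ, m < 0 ∧ 0 ≤ C ∧ 1 ≤ L₁ ∧ ∀ R : ℝ, L₁ ≤ R → J R ≤ C * R ^ m := by
    by_cases hc : (c : ℝ) = 0
    · -- `c = 0`: the `A`-growth already gives `J ≤ 0`
      refine ⟨-1, 0, 1, by norm_num, le_rfl, le_rfl, fun R hR => ?_⟩
      have hR0 : 0 < R := lt_of_lt_of_le one_pos hR
      have h := normEnergy_le_of_growth_loc (ρ := ρ) h0 h1 hzero hVm hA hR
      rw [hc, mul_zero] at h
      have hRp : 0 < R ^ (2 * ρ - 1) := Real.rpow_pos_of_pos hR0 _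
      have hJle : J R ≤ 0 := by
        have : R ^ (2 * ρ - 1) * J R ≤ R ^ (2 * ρ - 1) * 0 := by rw [mul_zero]; exact h
        exact le_of_mul_le_mul_left this hRp
      simpa using hJle
    have hcpos : 0 < (c : ℝ) := lt_of_le_of_ne hc0 (Ne.symm hc)
    have hEEσ : ∀ L : ℝ, 0 < L → (2 - 5 * g) * ∫ x, σ (L⁻¹ • x) * ‖V x‖ ^ 2 =
        (∫ x, (‖V x‖ ^ 2 + 2 * P x) * ⟪V x, gradient (fun z => σ (L⁻¹ • z)) x⟫) +
          g * ∫ x, ‖V x‖ ^ 2 * ⟪x, gradient (fun z => σ (L⁻¹ • z)) x⟫ :=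
      fun L hL => hEE _ (isTestFunctionOn_comp_inv_smul hσ hL.ne')
    have hderiv : ∀ r : ℝ, 0 < r →
        HasDerivAt (fun L : ℝ => L ^ ((2 - 5 * g) / g) * J L) (g⁻¹ * r ^ ((2 - 5 * g) / g - 1) * F r) r :=
      fun r hr => hasDerivAt_rpow_mul_cutoffEnergy_of_energyEquality_rate hg0 hσ hVm hV2 hr (hEEσ r hr)
    obtain ⟨A, hA0, hfluxW⟩ := exists_fluxWeight_le_of_sup_loc hρ hρ1 hσ h0 h1 hone hzero hVm hPm hGm hVG hA hE hD
      hPoisson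
    have hflux : ∀ S : ℝ, 0 ≤ S → S ≤ 3 * c → ∀ L : ℝ, 1 ≤ L →
        (∀ R : ℝ, L ≤ R → J R ≤ R ^ (1 - 2 * ρ) * S) →
        ∀ r : ℝ, L ≤ r → |(2 + ρ) * r ^ (2 * ρ - 2) * F r| ≤ A * S ^ (1 / 2 : ℝ) * r ^ (-1 - (2 + ρ) / 4) :=
      fun S hS hS3 L hL hsup r hr => hfluxW S hS hS3 L hL hsup r hr
    set C₀ : ℝ := (3 : ℝ) ^ (1 - 2 * ρ) * c with hC₀
    have hC₀0 : 0 ≤ C₀ := by rw [hC₀]; positivity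
    have hC₀3 : C₀ ≤ 3 * c := by
      have h3 : (3 : ℝ) ^ (1 - 2 * ρ) ≤ 3 := by
        conv_rhs => rw [← Real.rpow_one 3]
        exact Real.rpow_le_rpow_of_exponent_le (by norm_num) (by linarith)
      rw [hC₀]; gcongr
    have hbase : ∀ R : ℝ, 1 ≤ R → J R ≤ C₀ * R ^ (1 - 2 * ρ) := by
      intro R hR
      have hR0 : 0 < R := lt_of_lt_of_le one_pos hR
      have h := normEnergy_le_of_growth_loc (ρ := ρ) h0 h1 hzero hVm hA hR
      have hRR : R ^ (1 - 2 * ρ) * R ^ (2 * ρ - 1) = 1 := by rw [← Real.rpow_add hR0]; norm_num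
      calc J R = R ^ (1 - 2 * ρ) * (R ^ (2 * ρ - 1) * J R) := by rw [← mul_assoc, hRR, one_mul]
        _ ≤ R ^ (1 - 2 * ρ) * ((3 : ℝ) ^ (1 - 2 * ρ) * c) :=
            mul_le_mul_of_nonneg_left h (Real.rpow_nonneg hR0.le _)
        _ = C₀ * R ^ (1 - 2 * ρ) := by rw [hC₀]; ring
    exact negRate_iterate hρ hg hcpos hA0 hJ0 hflux hderiv hC₀0 hC₀3 hbase
  obtain ⟨m, C, L₁, hm, hC, hL₁, hb⟩ := hpow
  -- ### CONCLUSION: the energy of every ball vanishes (verbatim from ns-ezl-w6's file)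
  have hballzero : ∀ L₀ : ℝ, 0 < L₀ → ∫⁻ y in ball (0 : EuclideanSpace ℝ (Fin 3)) L₀, ‖V y‖ₑ ^ 2 = 0 := by
    intro L₀ hL₀
    refine le_antisymm (ENNReal.le_of_forall_pos_le_add fun δ hδ _ => ?_) zero_le
    rw [zero_add]
    have htend : Tendsto (fun L : ℝ => C * L ^ m) atTop (𝓝 (C * 0)) := by
      refine tendsto_const_nhds.mul ?_
      have := tendsto_rpow_neg_atTop (y := -m) (by linarith)
      simpa using this
    rw [mul_zero] at htend
    have hev := (htend.eventually (gt_mem_nhds (show (0 : ℝ) < δ from hδ))).and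
      (eventually_ge_atTop (max L₀ L₁))
    obtain ⟨L, hLδ, hLge⟩ := hev.exists
    have hLL₁ : L₁ ≤ L := (le_max_right _ _).trans hLge
    have hL0 : 0 < L := lt_of_lt_of_le (lt_of_lt_of_le one_pos hL₁) hLL₁
    have hLL₀ : L₀ ≤ L := (le_max_left _ _).trans hLge
    have h1 := lintegral_ball_sq_le_cutoffEnergy hσs.continuous hσc h0 hone hV2 hL0
    calc ∫⁻ y in ball (0 : EuclideanSpace ℝ (Fin 3)) L₀, ‖V y‖ₑ ^ 2
        ≤ ∫⁻ y in ball (0 : EuclideanSpace ℝ (Fin 3)) L, ‖V y‖ₑ ^ 2 := lintegral_mono_set (ball_subset_ball hLL₀)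
      _ ≤ ENNReal.ofReal (J L) := h1
      _ ≤ ENNReal.ofReal (C * L ^ m) := ENNReal.ofReal_le_ofReal (hb L hLL₁)
      _ ≤ (δ : ℝ≥0∞) := by
          rw [← ENNReal.ofReal_coe_nnreal]; exact ENNReal.ofReal_le_ofReal hLδ.le
  have hball_ae : ∀ n : ℕ, ∀ᵐ y ∂(volume.restrict (ball (0 : EuclideanSpace ℝ (Fin 3)) ((n : ℝ) + 1))), V y = 0 := by
    intro n
    have h := hballzero ((n : ℝ) + 1) (by positivity)
    rw [lintegral_eq_zero_iff' (hVm.restrict.enorm.pow_const 2)] at h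
    filter_upwards [h] with y hy
    simpa using hy
  have hunion : (⋃ n : ℕ, ball (0 : EuclideanSpace ℝ (Fin 3)) ((n : ℝ) + 1)) = univ := by
    refine eq_univ_of_forall fun y => mem_iUnion.2 ?_
    obtain ⟨n, hn⟩ := exists_nat_gt ‖y‖
    exact ⟨n, by rw [mem_ball, dist_zero_right]; linarith⟩
  have h := (ae_restrict_iUnion_iff (μ := (volume : Measure (EuclideanSpace ℝ (Fin 3))))
    (fun n : ℕ => ball (0 : EuclideanSpace ℝ (Fin 3)) ((n : ℝ) + 1)) (fun y => V y = 0)).2 hball_ae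
  rw [hunion, Measure.restrict_univ] at h
  exact h

end EnergySaturation

end Summit.NavierStokesRegularity.NavierStokesRegularity.Theorems.PowerGaugeEulerLiouville

end
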